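import Summits.Parity.BatemanHorn.Theorems.RoughParitySectorsRoughCountBand

/-!
# Crux `OddSectorShareNonlinear` (stmt-Parity-15628): what the odd-sector share buys for PRIME VALUES
# — the factor-`2^k` upper bound, the transfer of any odd-sector density to a Chebyshev lower bound,
# and "primes i.o. ↔ one odd rough value i.o."

Lead c4 of the crux, route `RoughParitySectors`.  Everything here is PROVED (no `sorry`, no new
definition, no new fact); the crux enters only as a HYPOTHESIS (per system: its conclusion `A_f`
verbatim; at route level: `OddSectorShareNonlinear` by name), so these are consequence certificates
(`--supports`), not progress on the open stub.

Notation (all predicates VERBATIM the route's): for a Bateman–Horn system `f` of `k` polynomials, a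
depth `U` and `x`, `R = R_f(x,U) = {1 ≤ n ≤ x : ∀ i, fᵢ(n) > 0, no prime p < ⌈x^{deg fᵢ/U}⌉₊ divides
fᵢ(n)}`, `c₁ = #{n ∈ R : ∀ i, Ω(fᵢ(n)) = 1}` (prime cell), `c_odd = #{n ∈ R : ∀ i, Ω(fᵢ(n)) odd}`,
`A = (U e^{−γ}/2)^k`, `m = C(f)/∏ deg fᵢ`, `L = (log x)^k`; `A_f` is the share statement
`∀ η > 0 ∃ U₀ ∀ U ≥ U₀ ∀ᶠ x, |c₁·A − c_odd| ≤ η·c_odd`.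

* `PrimeBounds.polyPrimeCount_upper_of_share` — **the parity-free half of the crux is already a prime
  bound beyond the sieve**: `A_f ⟹ ∀ ε > 0, ∀ᶠ x, polyPrimeCount f x · (log x)^k ≤ (2^k + ε)·m·x`.
  Only `c_odd ≤ #R` (trivial) and the PROVED band `roughCard_calibration` (`#R·L = x·m·2^k·A·(1 ± τ)`)
  are used: `c₁A ≤ (1+η)c_odd ≤ (1+η)#R`.  For `k = 1` this is `π_f(x) ≤ (2+ε)·(C(f)/deg f)·x/log x`,
  i.e. TWICE the Bateman–Horn main term, for every degree; the classical Selberg / linear-sieve upper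
  bound for the values of one polynomial of degree `d` (dimension 1, level of distribution `x^{1−ε}`
  in `n`, `F(s) = 2e^γ/s`) is `2·C(f)·x/log x`, i.e. `2d` times the Bateman–Horn main term
  `(C(f)/d)·x/log x` (Greaves, *Sieves in Number Theory*, Ch. 2 Thm 4: `π(f,X) ≤ 2^k k!·C·X/log^k X`,
  "exceeds the generally conjectured asymptotic value by the factor `2^k k!`" — for LINEAR factors;
  for a factor of degree `d` the conjectured value carries a further `1/d`), so along a nonlinear
  member even the upper half of the crux (`2×` instead of `2d×`) is not a known theorem.
* `PrimeBounds.polyPrimeCount_lower_of_share` — **transfer of ANY odd-sector density to primes**: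
  `A_f ⟹ ∀ δ ε > 0 ∃ U₂ ∀ U ≥ U₂ ∀ᶠ x, (δ·#R ≤ c_odd → (1−ε)·δ·2^k·m·x ≤ polyPrimeCount f x · L)`.
  So under the crux a positive lower density `δ` of the all-odd sector inside the rough values (at
  large depth, at the `x` in question) is worth a Chebyshev-order lower bound `δ·2^k` times
  Bateman–Horn; `δ = 2^{−k}(1 − o(1))` (the sibling crux `RoughParityBalance`) recovers Bateman–Horn
  (cf. `Exactness.asymptotic_of_balance_of_share`).
* Route level, by name: `oddSectorShareNonlinear_polyPrimeCount_upper`,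
  `oddSectorShareNonlinear_polyPrimeCount_lower`.

Reading.  The crux's docstring says the share "carries no information on the prime count beyond the
sieve factor `2^k`"; the kernel form of that sentence is the pair (upper: factor `2^k` outright;
lower: factor `δ·2^k` from any odd-sector density `δ`).  The qualitative shadow — granted the crux,
Bunyakovsky/Schinzel-type infinitude of prime values of a nonlinear system is exactly ONE parity flip
on its deep rough values, infinitely often, with the Landau instance `n² + 1` — is the companion file
`RoughParitySectorsOddSectorShareNonlinearParityFlip.lean`.

References: Bateman–Horn, Math. Comp. 16 (1962) (1)–(2) [BatemanHorn1962]; Halberstam–Richert,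
*Sieve Methods* (1974), Thm 2.5 (fundamental lemma) [HalberstamRichert1974]; G. Greaves, *Sieves in
Number Theory* (Springer, 2001), Ch. 2 Thm 4 and the remark after it; H. Iwaniec, Invent. Math. 47
(1978) [IwaniecInventiones1978].
-/

namespace Summit.Parity.BatemanHorn.Cruxes.OddSectorShareNonlinear.Birth

open Filter Finset Polynomial
open scoped Topology
open Literature.NumberTheory.Sieve
open Summit.Parity.BatemanHorn.Theorems.RoughCountBand

namespace PrimeBounds

/-! ### §1 Real arithmetic -/

/-- Upper squeeze at one `x`: `|c₁A − c_odd| ≤ ηc_odd`, `c_odd ≤ R`, `|RL − x·m·Q·A| ≤ η·x·m·Q·A`,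
`P ≤ c₁ + E`, `E·L ≤ ε·m·x/2`, `8Qη ≤ ε`, `η ≤ 1` give `P·L ≤ (Q + ε)·m·x`. [folklore] -/
theorem upper_arith {c₁ co R L x m Ak Q η ε E P : ℝ}
    (hL : 0 < L) (hx : 0 < x) (hm : 0 < m) (hAk : 0 < Ak) (hQ : 0 < Q) (hη : 0 < η) (hη1 : η ≤ 1)
    (hηε : 8 * Q * η ≤ ε)
    (h4 : |c₁ * Ak - co| ≤ η * co) (hcoR : co ≤ R)
    (h2 : |R * L - x * (m * (Q * Ak))| ≤ η * (x * (m * (Q * Ak))))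
    (hP : P ≤ c₁ + E) (hE : E * L ≤ ε * m * x / 2) :
    P * L ≤ (Q + ε) * m * x := by
  obtain ⟨h4b, -⟩ := abs_sub_le_iff.1 h4
  obtain ⟨h2a, -⟩ := abs_sub_le_iff.1 h2
  -- `c₁ Ak ≤ (1+η) R`
  have h5 : c₁ * Ak ≤ (1 + η) * R := by nlinarith
  -- `R L ≤ (1+η) x m Q Ak`
  have h6 : R * L ≤ (1 + η) * (x * (m * (Q * Ak))) := by linarith
  -- `c₁ L Ak ≤ (1+η)² x m Q Ak`, cancel `Ak`
  have h7 : c₁ * L * Ak ≤ (1 + η) ^ 2 * (Q * m * x) * Ak := by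
    have := mul_le_mul_of_nonneg_right h5 hL.le
    nlinarith [mul_le_mul_of_nonneg_left h6 (by linarith : (0 : ℝ) ≤ 1 + η)]
  have h8 : c₁ * L ≤ (1 + η) ^ 2 * (Q * m * x) := le_of_mul_le_mul_right h7 hAk
  have h9 : (1 + η) ^ 2 ≤ 1 + 3 * η := by nlinarith
  have h10 : (1 + η) ^ 2 * (Q * m * x) ≤ (1 + 3 * η) * (Q * m * x) :=
    mul_le_mul_of_nonneg_right h9 (by positivity)
  have h11 : 3 * η * Q ≤ ε / 2 := by nlinarith
  have hPL : P * L ≤ (c₁ + E) * L := mul_le_mul_of_nonneg_right hP hL.le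
  have hmx : 0 < m * x := mul_pos hm hx
  nlinarith [mul_le_mul_of_nonneg_right h11 hmx.le]

/-- Lower squeeze at one `x`: `|c₁A − c_odd| ≤ ηc_odd`, `δR ≤ c_odd`, `|RL − x·m·Q·A| ≤ η·x·m·Q·A`,
`c₁ ≤ P`, `2η ≤ ε`, `η ≤ 1` give `(1 − ε)·δ·Q·m·x ≤ P·L`. [folklore] -/
theorem lower_arith {c₁ co R L x m Ak Q η ε δ P : ℝ}
    (hL : 0 < L) (hx : 0 < x) (hm : 0 < m) (hAk : 0 < Ak) (hQ : 0 < Q) (hη : 0 < η) (hη1 : η ≤ 1)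
    (hδ : 0 ≤ δ) (hηε : 2 * η ≤ ε)
    (h4 : |c₁ * Ak - co| ≤ η * co) (hδR : δ * R ≤ co)
    (h2 : |R * L - x * (m * (Q * Ak))| ≤ η * (x * (m * (Q * Ak))))
    (hP : c₁ ≤ P) :
    (1 - ε) * δ * Q * m * x ≤ P * L := by
  obtain ⟨-, h4a⟩ := abs_sub_le_iff.1 h4
  obtain ⟨-, h2b⟩ := abs_sub_le_iff.1 h2
  -- `(1-η) co ≤ c₁ Ak` and `(1-η) x m Q Ak ≤ R L`
  have h5 : (1 - η) * co ≤ c₁ * Ak := by nlinarith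
  have h6 : (1 - η) * (x * (m * (Q * Ak))) ≤ R * L := by linarith
  have h1η : 0 ≤ 1 - η := by linarith
  -- `(1-η)² δ x m Q Ak ≤ c₁ Ak L`
  have h7 : (1 - η) * (δ * ((1 - η) * (x * (m * (Q * Ak))))) ≤ c₁ * Ak * L := by
    have e1 : δ * ((1 - η) * (x * (m * (Q * Ak)))) ≤ δ * (R * L) :=
      mul_le_mul_of_nonneg_left h6 hδ
    have e2 : δ * (R * L) ≤ co * L := by nlinarith
    have e3 : (1 - η) * (co * L) ≤ c₁ * Ak * L := by nlinarith
    nlinarith [mul_le_mul_of_nonneg_left (e1.trans e2) h1η]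
  have h8 : (1 - η) ^ 2 * (δ * (Q * (m * x))) * Ak ≤ c₁ * L * Ak := by nlinarith
  have h9 : (1 - η) ^ 2 * (δ * (Q * (m * x))) ≤ c₁ * L := le_of_mul_le_mul_right h8 hAk
  have h10 : 1 - ε ≤ (1 - η) ^ 2 := by nlinarith
  have h11 : (1 - ε) * (δ * (Q * (m * x))) ≤ (1 - η) ^ 2 * (δ * (Q * (m * x))) :=
    mul_le_mul_of_nonneg_right h10 (by positivity)
  have hPL : c₁ * L ≤ P * L := mul_le_mul_of_nonneg_right hP hL.le
  nlinarith

/-! ### §2 The factor-`2^k` upper bound from the share alone -/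

/-- **Upper half of the crux ⟹ `polyPrimeCount f x·(log x)^k ≤ (2^k + ε)·m·x` eventually.**  For a
Bateman–Horn system `f` whose jointly rough values satisfy the odd-sector share statement `A_f` (the
conclusion of `OddSectorShareNonlinear` / `OddSectorShareLinear` for `f`), the prime values obey the
Bateman–Horn upper bound up to the factor `2^k`: `c₁A ≤ (1+η)c_odd ≤ (1+η)#R` and the proved band
`#R·(log x)^k = x·m·2^kA·(1 ± η)`; the bookkeeping `polyPrimeCount ≤ c₁ + 1 + max Mᵢ + 2⌈x^{1/4}⌉₊` is
`primeCell_le_polyPrimeCount_le`.  No parity input is used. [folklore] -/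
theorem polyPrimeCount_upper_of_share {k : ℕ} {f : Fin k → ℤ[X]} (hf : IsBatemanHornSystem f)
    (hA : ∀ η : ℝ, 0 < η → ∃ U₀ : ℝ, ∀ U : ℝ, U₀ ≤ U → ∀ᶠ x : ℕ in Filter.atTop,
      |(((((Finset.Icc 1 x).filter (fun n : ℕ => ∀ i, 0 < (f i).eval (n : ℤ) ∧
          ∀ p ∈ Finset.range ⌈(x : ℝ) ^ (((f i).natDegree : ℝ) / U)⌉₊, p.Prime →
            ¬ ((p : ℤ) ∣ (f i).eval (n : ℤ)))).filter (fun n : ℕ => ∀ i,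
          ArithmeticFunction.cardFactors (((f i).eval (n : ℤ)).toNat) = 1)).card : ℕ) : ℝ) *
          (U * Real.exp (-Real.eulerMascheroniConstant) / 2) ^ k -
        (((((Finset.Icc 1 x).filter (fun n : ℕ => ∀ i, 0 < (f i).eval (n : ℤ) ∧
          ∀ p ∈ Finset.range ⌈(x : ℝ) ^ (((f i).natDegree : ℝ) / U)⌉₊, p.Prime →
            ¬ ((p : ℤ) ∣ (f i).eval (n : ℤ)))).filter (fun n : ℕ => ∀ i,
          Odd (ArithmeticFunction.cardFactors (((f i).eval (n : ℤ)).toNat)))).card : ℕ) : ℝ)| ≤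
        η * (((((Finset.Icc 1 x).filter (fun n : ℕ => ∀ i, 0 < (f i).eval (n : ℤ) ∧
          ∀ p ∈ Finset.range ⌈(x : ℝ) ^ (((f i).natDegree : ℝ) / U)⌉₊, p.Prime →
            ¬ ((p : ℤ) ∣ (f i).eval (n : ℤ)))).filter (fun n : ℕ => ∀ i,
          Odd (ArithmeticFunction.cardFactors (((f i).eval (n : ℤ)).toNat)))).card : ℕ) : ℝ)) :
    ∀ ε : ℝ, 0 < ε → ∀ᶠ x : ℕ in Filter.atTop,
      (polyPrimeCount f x : ℝ) * Real.log x ^ k ≤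
        (2 ^ k + ε) * (batemanHornConst f / ∏ i, ((f i).natDegree : ℝ)) * x := by
  intro ε hε
  obtain ⟨_, hC0⟩ := IsBatemanHornSystem.hasBatemanHornConst_holds hf
  set m : ℝ := batemanHornConst f / ∏ i, ((f i).natDegree : ℝ) with hm
  have hm0 : 0 < m := div_pos hC0 (prod_pos fun i _ => by exact_mod_cast hf.natDegree_pos i)
  have hQ : (0 : ℝ) < 2 ^ k := by positivity
  -- tolerance `η = min 1 (ε/(8·2^k))`
  set η : ℝ := min 1 (ε / (8 * 2 ^ k)) with hη
  have hη0 : 0 < η := lt_min one_pos (by positivity)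
  have hη1 : η ≤ 1 := min_le_left _ _
  have hηε : 8 * 2 ^ k * η ≤ ε := by
    have h1 : η ≤ ε / (8 * 2 ^ k) := min_le_right _ _
    rwa [le_div_iff₀ (by positivity), mul_comm] at h1
  obtain ⟨U_A, hAU⟩ := hA η hη0
  obtain ⟨U_R, hR⟩ := roughCard_calibration hf η hη0
  choose M hM using fun i =>
    Theorems.BalancedSemiprimeLayer.Negative.exists_pow_le_two_mul_eval (hf.leadingCoeff_pos i)
  set U : ℝ := max (max U_A U_R) (4 * ((univ.sup fun i => (f i).natDegree : ℕ) : ℝ) + 1) with hU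
  have hUA : U_A ≤ U := le_trans (le_max_left _ _) (le_max_left _ _)
  have hUR : U_R ≤ U := le_trans (le_max_right _ _) (le_max_left _ _)
  have hUc : 4 * ((univ.sup fun i => (f i).natDegree : ℕ) : ℝ) + 1 ≤ U := le_max_right _ _
  have hU0 : 0 < U := by
    linarith [Nat.cast_nonneg (α := ℝ) (univ.sup fun i => (f i).natDegree)]
  have habs := Cruxes.RoughValueLaw.IncrementAnchoring.SieveBand.eventually_absorb k
    (univ.sup M + 3) (by positivity : 0 < ε * m / 4)
  filter_upwards [hAU U hUA, hR U hUR, habs, eventually_ge_atTop 2] with x h4 h2 habsx hx2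
  obtain ⟨-, hE2⟩ := primeCell_le_polyPrimeCount_le hf M hM U x hUc hx2
  have hX : (0 : ℝ) < x := by exact_mod_cast (by omega : 0 < x)
  have hx1 : (1 : ℝ) ≤ x := by exact_mod_cast (by omega : 1 ≤ x)
  have hL0 : 0 < Real.log x ^ k := pow_pos (Real.log_pos (by exact_mod_cast hx2)) k
  have hAk : 0 < (U * Real.exp (-Real.eulerMascheroniConstant) / 2) ^ k := by positivity
  have hid : m * Real.exp (-((k : ℝ) * Real.eulerMascheroniConstant)) * U ^ k =
      m * ((2 : ℝ) ^ k * (U * Real.exp (-Real.eulerMascheroniConstant) / 2) ^ k) := by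
    rw [two_pow_mul_shareBase_pow, mul_assoc]
  rw [hid] at h2
  -- `c_odd ≤ #R`
  have hcoR : (((((Icc 1 x).filter (fun n : ℕ => ∀ i, 0 < (f i).eval (n : ℤ) ∧
      ∀ p ∈ range ⌈(x : ℝ) ^ (((f i).natDegree : ℝ) / U)⌉₊, p.Prime →
        ¬ ((p : ℤ) ∣ (f i).eval (n : ℤ)))).filter (fun n : ℕ => ∀ i,
      Odd (ArithmeticFunction.cardFactors (((f i).eval (n : ℤ)).toNat)))).card : ℕ) : ℝ) ≤
      ((((Icc 1 x).filter (fun n : ℕ => ∀ i, 0 < (f i).eval (n : ℤ) ∧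
      ∀ p ∈ range ⌈(x : ℝ) ^ (((f i).natDegree : ℝ) / U)⌉₊, p.Prime →
        ¬ ((p : ℤ) ∣ (f i).eval (n : ℤ)))).card : ℕ) : ℝ) := by
    exact_mod_cast card_filter_le _ _
  -- the bookkeeping error `E = (1 + max M) + 2⌈x^{1/4}⌉₊` has `E·L ≤ ε m x / 2`
  have hE : (((1 + univ.sup M : ℕ) : ℝ) + ((2 * ⌈(x : ℝ) ^ (1 / 4 : ℝ)⌉₊ : ℕ) : ℝ)) *
      Real.log x ^ k ≤ ε * m * x / 2 := by
    have hr1 : (1 : ℝ) ≤ (x : ℝ) ^ (1 / 4 : ℝ) := Real.one_le_rpow hx1 (by norm_num)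
    have hZ : (⌈(x : ℝ) ^ (1 / 4 : ℝ)⌉₊ : ℝ) ≤ (x : ℝ) ^ (1 / 4 : ℝ) + 1 :=
      (Nat.ceil_lt_add_one (by positivity)).le
    have hsum : ((1 + univ.sup M : ℕ) : ℝ) + ((2 * ⌈(x : ℝ) ^ (1 / 4 : ℝ)⌉₊ : ℕ) : ℝ) ≤
        2 * (((univ.sup M + 3 : ℕ) : ℝ) + ((x : ℝ) ^ (1 / 4 : ℝ)) ^ 2) := by
      push_cast
      nlinarith
    calc (((1 + univ.sup M : ℕ) : ℝ) + ((2 * ⌈(x : ℝ) ^ (1 / 4 : ℝ)⌉₊ : ℕ) : ℝ)) * Real.log x ^ k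
        ≤ 2 * (((univ.sup M + 3 : ℕ) : ℝ) + ((x : ℝ) ^ (1 / 4 : ℝ)) ^ 2) * Real.log x ^ k :=
          mul_le_mul_of_nonneg_right hsum hL0.le
      _ = 2 * ((((univ.sup M + 3 : ℕ) : ℝ) + ((x : ℝ) ^ (1 / 4 : ℝ)) ^ 2) * Real.log x ^ k) := by
          ring
      _ ≤ 2 * (ε * m / 4 * x) := mul_le_mul_of_nonneg_left habsx (by norm_num)
      _ = ε * m * x / 2 := by ring
  have hP : (polyPrimeCount f x : ℝ) ≤
      (((((Icc 1 x).filter (fun n : ℕ => ∀ i, 0 < (f i).eval (n : ℤ) ∧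
        ∀ p ∈ range ⌈(x : ℝ) ^ (((f i).natDegree : ℝ) / U)⌉₊, p.Prime →
          ¬ ((p : ℤ) ∣ (f i).eval (n : ℤ)))).filter (fun n : ℕ => ∀ i,
        ArithmeticFunction.cardFactors (((f i).eval (n : ℤ)).toNat) = 1)).card : ℕ) : ℝ) +
      (((1 + univ.sup M : ℕ) : ℝ) + ((2 * ⌈(x : ℝ) ^ (1 / 4 : ℝ)⌉₊ : ℕ) : ℝ)) := by
    have := (Nat.cast_le (α := ℝ)).2 hE2
    push_cast at this ⊢
    linarith
  exact upper_arith hL0 hX hm0 hAk hQ hη0 hη1 hηε h4 hcoR h2 hP hE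

/-! ### §3 Transfer of an odd-sector density to a Chebyshev lower bound -/

/-- **Crux ∧ odd-sector density `δ` ⟹ `polyPrimeCount ≥ (1−ε)·δ·2^k` × Bateman–Horn.**  For a
Bateman–Horn system `f` satisfying the share statement `A_f`, and `δ, ε > 0`, there is `U₂` such that
for every depth `U ≥ U₂`, eventually in `x`: IF the all-odd sector has density at least `δ` in the
jointly rough set at `(x, U)` (`δ·#R ≤ c_odd`), THEN `(1−ε)·δ·2^k·m·x ≤ polyPrimeCount f x·(log x)^k`.
(`c₁A ≥ (1−η)c_odd ≥ (1−η)δ#R`, band `#R·L ≥ (1−η)x·m·2^kA`, `c₁ ≤ polyPrimeCount`.)  The implication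
sits inside `∀ᶠ x`, so both the "eventually" and the "infinitely often" readings of the density
hypothesis transfer. [folklore] -/
theorem polyPrimeCount_lower_of_share {k : ℕ} {f : Fin k → ℤ[X]} (hf : IsBatemanHornSystem f)
    (hA : ∀ η : ℝ, 0 < η → ∃ U₀ : ℝ, ∀ U : ℝ, U₀ ≤ U → ∀ᶠ x : ℕ in Filter.atTop,
      |(((((Finset.Icc 1 x).filter (fun n : ℕ => ∀ i, 0 < (f i).eval (n : ℤ) ∧
          ∀ p ∈ Finset.range ⌈(x : ℝ) ^ (((f i).natDegree : ℝ) / U)⌉₊, p.Prime →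
            ¬ ((p : ℤ) ∣ (f i).eval (n : ℤ)))).filter (fun n : ℕ => ∀ i,
          ArithmeticFunction.cardFactors (((f i).eval (n : ℤ)).toNat) = 1)).card : ℕ) : ℝ) *
          (U * Real.exp (-Real.eulerMascheroniConstant) / 2) ^ k -
        (((((Finset.Icc 1 x).filter (fun n : ℕ => ∀ i, 0 < (f i).eval (n : ℤ) ∧
          ∀ p ∈ Finset.range ⌈(x : ℝ) ^ (((f i).natDegree : ℝ) / U)⌉₊, p.Prime →
            ¬ ((p : ℤ) ∣ (f i).eval (n : ℤ)))).filter (fun n : ℕ => ∀ i,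
          Odd (ArithmeticFunction.cardFactors (((f i).eval (n : ℤ)).toNat)))).card : ℕ) : ℝ)| ≤
        η * (((((Finset.Icc 1 x).filter (fun n : ℕ => ∀ i, 0 < (f i).eval (n : ℤ) ∧
          ∀ p ∈ Finset.range ⌈(x : ℝ) ^ (((f i).natDegree : ℝ) / U)⌉₊, p.Prime →
            ¬ ((p : ℤ) ∣ (f i).eval (n : ℤ)))).filter (fun n : ℕ => ∀ i,
          Odd (ArithmeticFunction.cardFactors (((f i).eval (n : ℤ)).toNat)))).card : ℕ) : ℝ)) :
    ∀ δ : ℝ, 0 < δ → ∀ ε : ℝ, 0 < ε → ∃ U₂ : ℝ, ∀ U : ℝ, U₂ ≤ U → ∀ᶠ x : ℕ in Filter.atTop,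
      δ * ((((Finset.Icc 1 x).filter (fun n : ℕ => ∀ i, 0 < (f i).eval (n : ℤ) ∧
          ∀ p ∈ Finset.range ⌈(x : ℝ) ^ (((f i).natDegree : ℝ) / U)⌉₊, p.Prime →
            ¬ ((p : ℤ) ∣ (f i).eval (n : ℤ)))).card : ℕ) : ℝ) ≤
        (((((Finset.Icc 1 x).filter (fun n : ℕ => ∀ i, 0 < (f i).eval (n : ℤ) ∧
          ∀ p ∈ Finset.range ⌈(x : ℝ) ^ (((f i).natDegree : ℝ) / U)⌉₊, p.Prime →
            ¬ ((p : ℤ) ∣ (f i).eval (n : ℤ)))).filter (fun n : ℕ => ∀ i,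
          Odd (ArithmeticFunction.cardFactors (((f i).eval (n : ℤ)).toNat)))).card : ℕ) : ℝ) →
      (1 - ε) * δ * 2 ^ k * (batemanHornConst f / ∏ i, ((f i).natDegree : ℝ)) * x ≤
        (polyPrimeCount f x : ℝ) * Real.log x ^ k := by
  intro δ hδ ε hε
  obtain ⟨_, hC0⟩ := IsBatemanHornSystem.hasBatemanHornConst_holds hf
  set m : ℝ := batemanHornConst f / ∏ i, ((f i).natDegree : ℝ) with hm
  have hm0 : 0 < m := div_pos hC0 (prod_pos fun i _ => by exact_mod_cast hf.natDegree_pos i)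
  have hQ : (0 : ℝ) < 2 ^ k := by positivity
  set η : ℝ := min 1 (ε / 2) with hη
  have hη0 : 0 < η := lt_min one_pos (by positivity)
  have hη1 : η ≤ 1 := min_le_left _ _
  have hηε : 2 * η ≤ ε := by linarith [min_le_right 1 (ε / 2)]
  obtain ⟨U_A, hAU⟩ := hA η hη0
  obtain ⟨U_R, hR⟩ := roughCard_calibration hf η hη0
  choose M hM using fun i =>
    Theorems.BalancedSemiprimeLayer.Negative.exists_pow_le_two_mul_eval (hf.leadingCoeff_pos i)
  refine ⟨max (max U_A U_R) (4 * ((univ.sup fun i => (f i).natDegree : ℕ) : ℝ) + 1),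
    fun U hU => ?_⟩
  have hUA : U_A ≤ U := le_trans (le_trans (le_max_left _ _) (le_max_left _ _)) hU
  have hUR : U_R ≤ U := le_trans (le_trans (le_max_right _ _) (le_max_left _ _)) hU
  have hUc : 4 * ((univ.sup fun i => (f i).natDegree : ℕ) : ℝ) + 1 ≤ U :=
    le_trans (le_max_right _ _) hU
  have hU0 : 0 < U := by
    linarith [Nat.cast_nonneg (α := ℝ) (univ.sup fun i => (f i).natDegree)]
  filter_upwards [hAU U hUA, hR U hUR, eventually_ge_atTop 2] with x h4 h2 hx2 hδR
  obtain ⟨hE1, -⟩ := primeCell_le_polyPrimeCount_le hf M hM U x hUc hx2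
  have hX : (0 : ℝ) < x := by exact_mod_cast (by omega : 0 < x)
  have hL0 : 0 < Real.log x ^ k := pow_pos (Real.log_pos (by exact_mod_cast hx2)) k
  have hAk : 0 < (U * Real.exp (-Real.eulerMascheroniConstant) / 2) ^ k := by positivity
  have hid : m * Real.exp (-((k : ℝ) * Real.eulerMascheroniConstant)) * U ^ k =
      m * ((2 : ℝ) ^ k * (U * Real.exp (-Real.eulerMascheroniConstant) / 2) ^ k) := by
    rw [two_pow_mul_shareBase_pow, mul_assoc]
  rw [hid] at h2
  have key := lower_arith hL0 hX hm0 hAk hQ hη0 hη1 hδ.le hηε h4 hδR h2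
    (show _ ≤ (polyPrimeCount f x : ℝ) by exact_mod_cast hE1)
  simpa only [mul_assoc] using key

end PrimeBounds

/-! ### §5 Route level: the crux `OddSectorShareNonlinear` BY NAME -/

open Summit.Parity.BatemanHorn.Theses.RoughParitySectors

/-- **`OddSectorShareNonlinear` ⟹ the factor-`2^k` Bateman–Horn UPPER bound** for the prime values of
every Bateman–Horn system with a member of degree `≥ 2`:
`polyPrimeCount f x·(log x)^k ≤ (2^k + ε)·(C(f)/∏deg fᵢ)·x` eventually.  (The parity-free half of the
crux; for one polynomial of degree `d ≥ 2` this is `d` times below the classical level-`x^{1−ε}`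
linear-sieve bound `2d·(C(f)/d)·x/log x`.) [folklore] -/
theorem oddSectorShareNonlinear_polyPrimeCount_upper :
    Summit.Parity.BatemanHorn.Theses.RoughParitySectors.OddSectorShareNonlinear →
    ∀ (k : ℕ) (f : Fin k → Polynomial ℤ), Literature.NumberTheory.Sieve.IsBatemanHornSystem f →
      (∃ i, 2 ≤ (f i).natDegree) → ∀ ε : ℝ, 0 < ε → ∀ᶠ x : ℕ in Filter.atTop,
        (Literature.NumberTheory.Sieve.polyPrimeCount f x : ℝ) * Real.log x ^ k ≤
          (2 ^ k + ε) * (Literature.NumberTheory.Sieve.batemanHornConst f /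
            ∏ i, ((f i).natDegree : ℝ)) * x :=
  fun h k f hf hd => PrimeBounds.polyPrimeCount_upper_of_share hf (h k f hf hd)

/-- **`OddSectorShareNonlinear` ⟹ any odd-sector density `δ` of the deep rough values of a nonlinear
system is worth the Chebyshev lower bound `(1−ε)·δ·2^k·(C(f)/∏deg fᵢ)·x ≤ polyPrimeCount f x·(log x)^k`**
(for `U ≥ U₂(δ, ε)`, eventually in `x`, at every `x` where `δ·#R ≤ c_odd`). [folklore] -/
theorem oddSectorShareNonlinear_polyPrimeCount_lower (h : OddSectorShareNonlinear) :
    ∀ (k : ℕ) (f : Fin k → ℤ[X]), IsBatemanHornSystem f → (∃ i, 2 ≤ (f i).natDegree) →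
      ∀ δ : ℝ, 0 < δ → ∀ ε : ℝ, 0 < ε → ∃ U₂ : ℝ, ∀ U : ℝ, U₂ ≤ U → ∀ᶠ x : ℕ in Filter.atTop,
        δ * ((((Finset.Icc 1 x).filter (fun n : ℕ => ∀ i, 0 < (f i).eval (n : ℤ) ∧
            ∀ p ∈ Finset.range ⌈(x : ℝ) ^ (((f i).natDegree : ℝ) / U)⌉₊, p.Prime →
              ¬ ((p : ℤ) ∣ (f i).eval (n : ℤ)))).card : ℕ) : ℝ) ≤
          (((((Finset.Icc 1 x).filter (fun n : ℕ => ∀ i, 0 < (f i).eval (n : ℤ) ∧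
            ∀ p ∈ Finset.range ⌈(x : ℝ) ^ (((f i).natDegree : ℝ) / U)⌉₊, p.Prime →
              ¬ ((p : ℤ) ∣ (f i).eval (n : ℤ)))).filter (fun n : ℕ => ∀ i,
            Odd (ArithmeticFunction.cardFactors (((f i).eval (n : ℤ)).toNat)))).card : ℕ) : ℝ) →
        (1 - ε) * δ * 2 ^ k * (batemanHornConst f / ∏ i, ((f i).natDegree : ℝ)) * x ≤
          (polyPrimeCount f x : ℝ) * Real.log x ^ k :=
  fun k f hf hd => PrimeBounds.polyPrimeCount_lower_of_share hf (h k f hf hd)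

end Summit.Parity.BatemanHorn.Cruxes.OddSectorShareNonlinear.Birth
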